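import Mathlib
import Summits.NavierStokesRegularity.NavierStokesRegularity.Theses.TrappingWindowRungThree
import HarnessLib

/-!
# `TrappingWindowRungThree.Assembly` — the route's assembly (item stmt-NavierStokesRegularity-21753;
  pure logic)

**Statement.** `WindowCertificate → TailEnvelopes → TrappingBootstrap → RestartControl → RestartGlue →
LocalDynamicsSufficesAt → TaoLadderRungThree.Target`.

PROOF. The route file `Theses/TrappingWindowRungThree.lean` carries the planner-authored,
kernel-checked deciding theorem `Theses.TrappingWindowRungThree.closes`, whose hypotheses are exactly
the route's two cruxes and four supports and whose conclusion is the rung leaf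
`TaoLadderRungThree.Target` (TL-M3, D-0061); the assembly item is that implication written as ONE
proposition, so it is closed by applying `closes` to the hypotheses.

HONEST FRAMING: glue between the route's own statements about a MODEL lattice (Tao 2016's dyadic
comparable-table cascade); nothing here is a statement about the Navier–Stokes equations, and the
rung leaf is not the summit Statement.
-/

noncomputable section

set_option linter.dupNamespace false

namespace Summit.NavierStokesRegularity.NavierStokesRegularity.Theorems

open Summit.NavierStokesRegularity.NavierStokesRegularity.Theses.TrappingWindowRungThree in
/-- **Item stmt-NavierStokesRegularity-21753** (`TrappingWindowRungThree.Assembly`): the route's two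
cruxes and four supports imply its rung leaf `TaoLadderRungThree.Target`, by the route file's
deciding theorem `closes`. [this file] -/
theorem trappingWindowRungThree_assembly_proof :
    Summit.NavierStokesRegularity.NavierStokesRegularity.Theses.TrappingWindowRungThree.Assembly := by
  unfold Summit.NavierStokesRegularity.NavierStokesRegularity.Theses.TrappingWindowRungThree.Assembly
  intro h₁ h₂ h₃ h₄ h₅ h₆
  exact closes h₁ h₂ h₃ h₄ h₅ h₆

end Summit.NavierStokesRegularity.NavierStokesRegularity.Theorems

end
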